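import Summits.ResolutionOfSingularities.ResolutionOfSingularities.Theorems.EquisingularLiftEquisingularLiftNatValuationDominatedBad
import Literature.AlgebraicGeometry.Resolution.BlowupPointBranches
import HarnessLib

/-!
# [OURS · L1 W4.5(b) · EL♮] K-VAL-CENTRE-UNIQ (U-3c): DSHARP-VOID §2 (2a) in the AMBIENT frame — the image in the ambient blow-up
# of THE centre of `v` on the strict transform is a BAD point
# (crux `EquisingularLiftNat` = stmt-ResolutionOfSingularities-20038; PARENT ≥ 4 band / kill test #50 K5-BMY)

HONEST FRAMING. OURS (cell res-hironaka, crux chain w45b, slot W4.5(b)); NOT a statement of any manuscript; replaces the role of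
NOTHING in the manuscript; AI-written, AI review is weaker than expert review. Helper `--supports stmt-ResolutionOfSingularities-20038
--as helper`. Last piece of res-D-brk-4 g9's cut (2026-08-27T20:28:48Z) of object «(U) K-VAL-CENTRE-UNIQ» (res-L1-w45b-plan-1 RULING
20:06:38Z); sequel of p563432 · p565158 · p568114 · p569464 · p570182 · `…NatValuationDominatedBad` (`bad_of_localHom`).

THE STATEMENT (`bad_apply_of_isCentre`). A commutative square `j ≫ π = ρ ≫ i` — `π : X′ → X` the AMBIENT blowing up along `J`
(`P_{j+1} → P_j` of the memo), `ρ : Y′ → Y` a blowing up of the INTEGRAL locally Noetherian `Y` (`Y_{j+1} → Y_j`, the strict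
transform; `i`, `j` any morphisms making the square commute) —, a base `r : X → Spec O`, `ϖ ∈ O`, a point `y′ ∈ Y′`, the RIBBON data
at `π (j y′)` (generators `c` of the stalk of `J`, all in `𝔪`; `g ∈ (c)`; `ϖ − g ∈ 𝔪²`), a valuation ring `V ⊆ K(Y)` dominating
`𝒪_{Y,ρ y′}` (the hypotheses `hV`/`hloc` of the tree's `BlowupPointBranches.lean`) with `V(g|_Y) < V(cᵢ|_Y)` for some `i` (values read
through `φ = (𝒪_{Y,ρ y′} ⊆ K(Y)) ∘ i^♯ ∘ (𝒪_{X,π(j y′)} ≅ 𝒪_{X,i(ρ y′)})`, handed over as `φ` with its defining equation `hφ`), and `y′`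
a CENTRE of `V` on `Y′` in the tree's sense: a LOCAL `G : 𝒪_{Y′,y′} → V` inducing the canonical embedding `hρ.stalkEmb y′`. Such a
centre EXISTS for `ρ` proper (`IsBlowup.exists_point_stalkEmb_mem`) and is UNIQUE for `ρ` separated, `Y′` integral
(`IsBlowup.eq_of_stalkEmb_factors` — the «uniqueness of centres» sentence of the memo). CONCLUSION: `j y′` is BAD in the AMBIENT
blow-up — the germ of `ϖ` at `j y′` w.r.t. `π ≫ r` lies in `𝔪²_{X′, j y′}` (the `…NatBadLocus` currency that (2c) of the memo consumes:
every later regular `O`-flat centre through it has multiplicity `≥ 2` there, `RibbonMultiplicity.two_le_addVal_varpiGerm_of_bad`).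
PROOF: `G ∘ j^♯_{y′}` is local over `φ` because `j^♯ ∘ π^♯ = ρ^♯ ∘ i^♯` on stalks (`Scheme.Hom.stalkMap_congr_hom` /
`stalkMap_comp` from `j ≫ π = ρ ≫ i`) and `ε_{y′} ∘ ρ^♯ = (𝒪_Y ⊆ K(Y))` (`IsBlowup.stalkEmb_stalkMap`); then `bad_of_localHom`.

With this file the by-hand step (2a) of `DSHARP-VOID.md` §2 («RIBBON AT A GOOD POINT ⇒ the `v`-centre JUMPS ONTO THE BAD LINE … by
uniqueness of centres `x′(𝔓_v) = η_{Z_{j+1}}`») is a kernel theorem in the frame the memo uses, the centre being the tree's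
`IsBlowup`-centre of `V = 𝒪_v ⊆ K(Y_j)` on `Y_{j+1}`. What remains by hand around it is only the memo's own framing (the V-AV frame:
that `Z_{j+1}` IS the closure of that centre, and the good-point normal form (1e) supplying the ribbon data).

References: [Kollar2007, §1.4]; [StacksProject, Tag 01KF, 01KZ, 0804]; [GortzWedhorn2020, Prop. 13.91, 13.96]; [ZariskiSamuel1960,
Ch. VI §5, §17]; tree `…Resolution/BlowupPointBranches.lean`, `…Resolution/BlowupStalkEmbedding.lean`, `…NatValuationDominatedBad`.
-/

set_option linter.dupNamespace false -- mandated namespace `Summit.<Summit>.<Problem>` of this single-conjunct summit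

noncomputable section

open IsLocalRing IsLocalization
open Literature.AlgebraicGeometry.Resolution

namespace Summit.ResolutionOfSingularities.ResolutionOfSingularities.Cruxes.EquisingularLiftNat.Sections

namespace ValChartCentre

open CategoryTheory AlgebraicGeometry TopologicalSpace
open AlgebraicGeometry.Scheme.IdealSheafData

/-- For a local homomorphism of local rings, membership in the maximal ideal is reflected and preserved. [folklore] -/
theorem mem_maximalIdeal_iff_of_isLocalHom {A B : Type*} [CommRing A] [CommRing B] [IsLocalRing A] [IsLocalRing B]
    (f : A →+* B) [hf : IsLocalHom f] (a : A) : a ∈ maximalIdeal A ↔ f a ∈ maximalIdeal B := by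
  rw [IsLocalRing.mem_maximalIdeal, IsLocalRing.mem_maximalIdeal, mem_nonunits_iff, mem_nonunits_iff]
  exact ⟨fun h hu => h (hf.map_nonunit a hu), fun h hu => h (hu.map f)⟩

variable {X' X Y' Y : Scheme.{0}} {π : X' ⟶ X} {J : X.IdealSheafData} {ρ : Y' ⟶ Y} {JY : Y.IdealSheafData}
  {i : Y ⟶ X} {j : Y' ⟶ X'}

/-- Along `j ≫ π = ρ ≫ i`: `π (j y′) = i (ρ y′)`. [folklore] -/
theorem apply_apply_eq_of_comp_eq (hj : j ≫ π = ρ ≫ i) (y' : Y') : π (j y') = i (ρ y') := by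
  rw [← Scheme.Hom.comp_apply, hj, Scheme.Hom.comp_apply]

/-- **DSHARP-VOID §2 (2a), AMBIENT FRAME — the image of THE `v`-centre of the strict transform in the ambient blow-up is BAD.**
A commutative square `j ≫ π = ρ ≫ i` (`π : X′ → X` the AMBIENT blowing up along `J`, `ρ : Y′ → Y` a blowing up of the INTEGRAL
locally Noetherian `Y` — e.g. the strict transform —, `i`, `j` arbitrary morphisms), a base `r : X → Spec O`, `ϖ ∈ O`; a point `y′ ∈ Y′`
and the RIBBON data at `π (j y′)` (generators `c` of `J_{π(j y′)}` in `𝔪`, `g ∈ (c)`, `ϖ − g ∈ 𝔪²`); a valuation ring `V ⊆ K(Y)`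
dominating `𝒪_{Y,ρ y′}` (tree hypotheses `hV`/`hloc` of `BlowupPointBranches.lean`) with `V(g|_Y) < V(cᵢ|_Y)` for some `i` (values
read through `φ = (𝒪_{Y,ρ y′} ⊆ K(Y)) ∘ i^♯ ∘ (𝒪_{X,π(j y′)} ≅ 𝒪_{X,i(ρ y′)})`); and `y′` a `V`-CENTRE of `ρ` in the tree's sense
(a local `G : 𝒪_{Y′,y′} → V` inducing `ε_{y′} = hρ.stalkEmb y′`; it exists for `ρ` proper and is UNIQUE for `ρ` separated and `Y′`
integral: `IsBlowup.exists_point_stalkEmb_mem` / `eq_of_stalkEmb_factors`). THEN `j y′` is BAD in the ambient blow-up: the germ of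
`ϖ` at `j y′` (w.r.t. `π ≫ r`) lies in `𝔪_{j y′}²`. Proof: `G ∘ j^♯_{y′}` is a local homomorphism `𝒪_{X′,j y′} → V` over `φ`
(`j^♯ ∘ π^♯ = ρ^♯ ∘ i^♯` on stalks, `ε ∘ ρ^♯ = (𝒪_Y ⊆ K(Y))`), and `bad_of_localHom` applies. OURS. [folklore] -/
theorem bad_apply_of_isCentre [IsIntegral Y] [IsLocallyNoetherian Y] (hρ : IsBlowup ρ JY) (hj : j ≫ π = ρ ≫ i)
    {O : Type} [CommRing O] (r : X ⟶ Spec (.of O)) (ϖ : O) (hπ : IsBlowup π J) (y' : Y')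
    {k : ℕ} (c : Fin k → X.presheaf.stalk (π (j y')))
    (hc : Ideal.span (Set.range c) = stalkIdeal J (π (j y'))) (hc𝔪 : ∀ i, c i ∈ maximalIdeal (X.presheaf.stalk (π (j y'))))
    {g : X.presheaf.stalk (π (j y'))} (hg : g ∈ Ideal.span (Set.range c))
    (hrib : (X.presheaf.Γgerm (π (j y'))).hom (r.appTop.hom ((Scheme.ΓSpecIso (.of O)).inv.hom ϖ)) - g ∈
      (maximalIdeal (X.presheaf.stalk (π (j y')))) ^ 2)
    (V : ValuationSubring Y.functionField)
    (hV : ∀ u : Y.presheaf.stalk (ρ y'), algebraMap (Y.presheaf.stalk (ρ y')) Y.functionField u ∈ V)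
    (hloc : IsLocalHom (stalkToValuationSubring (ρ y') V hV))
    (φ : X.presheaf.stalk (π (j y')) →+* Y.functionField)
    (hφ : ∀ t, φ t = algebraMap (Y.presheaf.stalk (ρ y')) Y.functionField
      ((i.stalkMap (ρ y')).hom ((X.presheaf.stalkCongr (.of_eq (apply_apply_eq_of_comp_eq hj y'))).hom.hom t)))
    (hvg : ∃ i₀, V.valuation (φ g) < V.valuation (φ (c i₀)))
    (G : Y'.presheaf.stalk y' →+* V) [hGloc : IsLocalHom G] (hG : (V.subtype).comp G = hρ.stalkEmb y') :
    (X'.presheaf.Γgerm (j y')).hom ((π ≫ r).appTop.hom ((Scheme.ΓSpecIso (.of O)).inv.hom ϖ)) ∈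
      (maximalIdeal (X'.presheaf.stalk (j y'))) ^ 2 := by
  have hpt : π (j y') = i (ρ y') := apply_apply_eq_of_comp_eq hj y'
  -- the transport `𝒪_{X,π(j y′)} ≅ 𝒪_{X,i(ρ y′)}` and `ψ = i^♯ ∘ transport`
  let τ : X.presheaf.stalk (π (j y')) ⟶ X.presheaf.stalk (i (ρ y')) := (X.presheaf.stalkCongr (.of_eq hpt)).hom
  haveI : IsLocalHom τ.hom := isLocalHom_of_isIso τ
  let ψ : X.presheaf.stalk (π (j y')) →+* Y.presheaf.stalk (ρ y') := (i.stalkMap (ρ y')).hom.comp τ.hom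
  haveI hψloc : IsLocalHom ψ := RingHom.isLocalHom_comp _ _
  have hφψ : ∀ t, φ t = algebraMap (Y.presheaf.stalk (ρ y')) Y.functionField (ψ t) := fun t => hφ t
  -- the local homomorphism `G ∘ j^♯` over `φ`
  let GX : X'.presheaf.stalk (j y') →+* V := G.comp (j.stalkMap y').hom
  haveI : IsLocalHom GX := RingHom.isLocalHom_comp _ _
  have hsq : ∀ t, (j.stalkMap y').hom ((π.stalkMap (j y')).hom t) = (ρ.stalkMap y').hom (ψ t) := by
    intro t
    have h3 := Scheme.Hom.stalkMap_congr_hom (j ≫ π) (ρ ≫ i) hj y'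
    rw [Scheme.Hom.stalkMap_comp, Scheme.Hom.stalkMap_comp] at h3
    have h4 := congrArg (fun f => (CommRingCat.Hom.hom f) t) h3
    simp only [CommRingCat.hom_comp, RingHom.comp_apply] at h4
    exact h4
  have hGX : ∀ t, (GX ((π.stalkMap (j y')).hom t) : Y.functionField) = φ t := by
    intro t
    show ((V.subtype.comp G) ((j.stalkMap y').hom ((π.stalkMap (j y')).hom t))) = φ t
    rw [hsq, hG, hρ.stalkEmb_stalkMap, hφψ]
  -- the hypotheses of `bad_of_localHom`
  have hVX : ∀ t, φ t ∈ V := fun t => by rw [hφψ]; exact hV _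
  have hcent : ∀ t, t ∈ maximalIdeal (X.presheaf.stalk (π (j y'))) ↔ V.valuation (φ t) < 1 := by
    intro t
    rw [mem_maximalIdeal_iff_of_isLocalHom ψ t, mem_maximalIdeal_iff_of_isLocalHom (stalkToValuationSubring (ρ y') V hV),
      ValuationSubring.valuation_lt_one_iff, hφψ]
    rfl
  exact bad_of_localHom r ϖ hπ (j y') c hc hc𝔪 hg hrib φ V hVX hcent hvg GX hGX

end ValChartCentre

end Summit.ResolutionOfSingularities.ResolutionOfSingularities.Cruxes.EquisingularLiftNat.Sections
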